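import Mathlib
import HarnessLib
import Summits.QuantumFields.YangMills.Theses.FradkinShenkerFlow

/-!
# Sketch — crux-ideate stmt-QuantumFields-9442 (FiniteSusceptibilityWeakCoupling), ideator 1, round 1

First lemmas of the two idea cards, stated over existing declarations (they need not be proved
here; they must elaborate).

* Card A `sup-axis-reflection-transfer`: `AxisMomentToSusceptibility` (time-axis cubic-moment
  absolute summability for all pairs ⇒ the all-direction ℓ¹ susceptibility bound of the crux, at
  fixed `β ≥ 0`, by four-axis reflection positivity + Cauchy–Schwarz in the transfer-operator form
  + shell counting `#{‖x‖∞ = t} ≤ 8(2t+1)³`), and the sibling-attachment corollary shape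
  `AxisClusteringToSusceptibility`.
* Card B `semisimple-quadratic-onset`: `SimpleRepDetOne` (simple ⇒ special: `det ∘ ρ = 1`),
  `OddTraceActionBound` (for unitary `V` with `det V = 1`, `|Im tr V| ≤ C_N (N − Re tr V)^{3/2}`:
  the C-odd part of every Wilson character is of order 3/2 in the action density), and the
  transfer target `InfraredWindowExclusion` (axis decay faster than `t^{-4-δ}`), with the
  composition shape `window_to_crux`.
-/

open scoped BigOperators
open MeasureTheory ProbabilityTheory

namespace Summit.QuantumFields.YangMills.Cruxes.FiniteSusceptibilityWeakCoupling.Ideator1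

open Literature.MathematicalPhysics.QuantumFieldTheory Literature.MathematicalPhysics.QuantumLattice
  Literature.Probability.LatticeModels

section Defs

variable {G : Type} [Group G] [TopologicalSpace G] [IsTopologicalGroup G] [CompactSpace G]
  [MeasurableSpace G] [BorelSpace G]

/-- The crux's partial susceptibility: `Σ_{x ∈ box 4 S} |Cov_{β,S}(A∘lift, B∘τ_x∘lift)|` on the torus
of side `2S+1`. -/
noncomputable def boxAbsCov (r : LatticeRep G) (β : ℝ) (S : ℕ) (A B : YMSpecies G) : ℝ :=
  ∑ x ∈ box 4 S, |covariance (fun U => A.F (torusLift (2 * S + 1) U))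
      (fun U => B.F (configShift (-x) (torusLift (2 * S + 1) U)))
      (wilsonMeasure (d := 4) (L := 2 * S + 1) r.ρ β)|

/-- Time-axis cubic moment: `Σ_{n ≤ S} (n+1)³ |Cov_{β,S}(A∘lift, B∘τ_{n e₀}∘lift)|`. -/
noncomputable def axisCubicMoment (r : LatticeRep G) (β : ℝ) (S : ℕ) (A B : YMSpecies G) : ℝ :=
  ∑ n ∈ Finset.range (S + 1), ((n : ℝ) + 1) ^ 3 *
    |covariance (fun U => A.F (torusLift (2 * S + 1) U))
      (fun U => B.F (configShift (-(Pi.single (0 : Fin 4) (n : ℤ))) (torusLift (2 * S + 1) U)))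
      (wilsonMeasure (d := 4) (L := 2 * S + 1) r.ρ β)|

end Defs

/-- **Card A, first lemma (transfer lemma).** At fixed `β ≥ 0`: if for every pair of gauge-invariant
local observables the TIME-AXIS covariances have absolutely summable cubic moments, uniformly in
the torus, then every pair has finite all-direction susceptibility, uniformly in the torus.
Mechanism: reflection positivity of the odd torus in each of the four axis directions (site
reflection at `0`, link reflection at the antipode; `β ≥ 0`) makes `(X, Y) ↦ Cov(ΘX, τ_t Y)` a
positive semidefinite form implemented by `T^t`, `T ≥ 0`; Cauchy–Schwarz in the direction `μ`
with `|x_μ| = ‖x‖∞ = t` removes the transverse displacement by translation invariance,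
`|Cov(ΘA, τ_x B)| ≤ (D_A(t) D_B(t))^{1/2} ≤ (D_A(t) + D_B(t))/2`, and `#{x : ‖x‖∞ = t} ≤ 8(2t+1)³`;
hypercubic symmetry moves axis `μ` to axis `0`; `ΘA`, `RA` are again `YMSpecies`. -/
def AxisMomentToSusceptibility : Prop :=
  ∀ (G : Type) [Group G] [TopologicalSpace G] [IsTopologicalGroup G] [CompactSpace G]
    [MeasurableSpace G] [BorelSpace G],
    ∀ (r : LatticeRep G) (β : ℝ), 0 ≤ β →
      (∀ A B : YMSpecies G, ∃ M : ℝ, ∀ S : ℕ, axisCubicMoment r β S A B ≤ M) →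
      ∀ A B : YMSpecies G, ∃ χ : ℝ, ∀ S : ℕ, boxAbsCov r β S A B ≤ χ

/-- **Card A, corollary shape (sibling attachment).** Volume-uniform exponential clustering in
Euclidean TIME for all pairs at all `β ≥ β₁(G, r)` (the shape of the sibling lattice-gap legs,
e.g. `EquipartitionCriticality.LatticeGapLargeBeta`) implies the crux: `Σ (n+1)³ C e^{-mn} < ∞`,
small tori `S < S₀` are absorbed in the constant, `β₀ := max β₁ 0`. -/
def AxisClusteringToSusceptibility : Prop :=
  (∀ (G : Type) [Group G] [TopologicalSpace G] [IsTopologicalGroup G] [CompactSpace G]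
    [MeasurableSpace G] [BorelSpace G],
    IsCompactSimpleLieGroup G → ∀ r : LatticeRep G, ∃ β₁ : ℝ, ∀ β : ℝ, β₁ ≤ β → ∃ m : ℝ, 0 < m ∧
      ∀ A B : YMSpecies G, ∃ C : ℝ, ∃ S₀ : ℕ, ∀ S : ℕ, S₀ ≤ S → ∀ n : ℕ, n ≤ S →
        |latticeConnectedCorr r.ρ β (2 * S + 1) A.F B.F n| ≤ C * Real.exp (-(m * n))) →
  Summit.QuantumFields.YangMills.Theses.FradkinShenkerFlow.FiniteSusceptibilityWeakCoupling

/-- Shape check: the corollary follows from the transfer lemma (p-series; not proved in this sketch). -/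
theorem axisClustering_of_axisMoment (h : AxisMomentToSusceptibility) :
    AxisClusteringToSusceptibility := by
  sorry

/-- **Card B, first lemma (simple ⇒ special).** A compact simple Lie group has no non-trivial
continuous character, so every lattice representation lands in `SU(N)`: `det ρ(g) = 1`.
Infinitesimally: `dρ(𝔤) ⊆ 𝔰𝔲(N)` is traceless (`𝔤 = [𝔤, 𝔤]`), i.e. the LINEAR term of every Wilson
character at the flat configuration vanishes — the algebraic reason why gauge-invariant local
observables couple to curvature only quadratically for simple `G` (false for `U(1)`). -/
def SimpleRepDetOne : Prop :=
  ∀ (G : Type) [Group G] [TopologicalSpace G] [IsTopologicalGroup G] [CompactSpace G],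
    IsCompactSimpleLieGroup G → ∀ (r : LatticeRep G) (g : G), (r.ρ g).det = 1

/-- **Card B, first lemma (C-odd characters are infrared-irrelevant).** For a unitary matrix of
determinant one, the imaginary part of the trace is of order `3/2` in the "action density"
`N − Re tr V` (eigenvalue angles sum to `0`: `Σ sin θ_k = −Σ θ_k³/6 + …`, while
`N − Re tr V = Σ (1 − cos θ_k) ≍ Σ θ_k²`); for `U(1)` (`det ≠ 1`) it is of order `1/2`
(`sin θ` vs `1 − cos θ`), which is exactly the C-odd, dimension-two observable that makes the
abelian susceptibility diverge logarithmically. -/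
def OddTraceActionBound : Prop :=
  ∀ N : ℕ, ∃ C : ℝ, ∀ V : Matrix (Fin N) (Fin N) ℂ, V ∈ Matrix.unitaryGroup (Fin N) ℂ → V.det = 1 →
    |V.trace.im| ≤ C * ((N : ℝ) - V.trace.re) ^ (3 / 2 : ℝ)

/-- **Card B, transfer target `C⁺` (infrared window exclusion).** At weak coupling every pair of
gauge-invariant local observables has time-axis connected correlations decaying faster than
`(n+1)^{-(4+δ)}`, volume-uniformly: "no gauge-invariant field of infrared dimension `≤ d/2 = 2`"
— strictly weaker than exponential clustering, strictly stronger than the crux. -/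
def InfraredWindowExclusion : Prop :=
  ∀ (G : Type) [Group G] [TopologicalSpace G] [IsTopologicalGroup G] [CompactSpace G]
    [MeasurableSpace G] [BorelSpace G],
    IsCompactSimpleLieGroup G → ∀ r : LatticeRep G, ∃ β₀ : ℝ, ∀ β : ℝ, β₀ ≤ β →
      ∀ A B : YMSpecies G, ∃ C δ : ℝ, 0 < δ ∧ ∀ S n : ℕ, n ≤ S →
        |latticeConnectedCorr r.ρ β (2 * S + 1) A.F B.F n| ≤ C * ((n : ℝ) + 1) ^ (-(4 + δ))

/-- Shape check: window exclusion + the transfer lemma give the crux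
(`Σ (n+1)³ (n+1)^{-(4+δ)} < ∞`; `β₀ := max β₀ 0`; not proved in this sketch). -/
theorem window_to_crux (hA : AxisMomentToSusceptibility) (hW : InfraredWindowExclusion) :
    Summit.QuantumFields.YangMills.Theses.FradkinShenkerFlow.FiniteSusceptibilityWeakCoupling := by
  sorry

end Summit.QuantumFields.YangMills.Cruxes.FiniteSusceptibilityWeakCoupling.Ideator1
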